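import Mathlib
import HarnessLib
import HarnessLib.Audit
import Summits.ValiantsHypothesis.ValiantsHypothesis.Theorems.LacunarySymmetroidMatrixDescartesZeroChangeRows

/-!
# ValiantsHypothesis / LacunarySymmetroid — crux `MatrixDescartes` (stmt-ValiantsHypothesis-18050, V1), LINE (A) «product_plus_one»:
# the first rung `OneRowZeroChange 1` of NOTE §56.5 (γ) (pen val-idea-25 g9; Sketch-ZC-s58)

The pen's Sketch-ZC-s58 (97afcd383662b9cb) types the OPEN ladder `OneRowZeroChange k` («one W row and `k` zero-change rows have at
most `2k + 1` positive critical points»; located value 3 for `k ≤ 3`).  Its FIRST RUNG `k = 1` is THEOREM 56.2 (a) (`twoRowWKK`,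
module `…ZeroChangeRows`): a single zero-change row `(p, q, s)` with `p, s > 0 ≤ q` is exactly the KK-type row of 56.2 (a).  This file
records the rung in the pen's own wording (`oneRowZeroChange_one` = the Sketch's `OneRowZeroChange 1` body VERBATIM).  The rungs
`k ≥ 2` are OPEN (located) and NOT claimed.

HONEST FRAMING: free-standing helper; no stub of LINE (A) is touched (A40 unchanged, sorries 4 → 4); `MatrixDescartes` OPEN;
`VP ≠ VNP` is NOT proved and nothing here bears on it.
-/

set_option linter.dupNamespace false

namespace Summit.ValiantsHypothesis.ValiantsHypothesis.Theorems.LacunarySymmetroidMatrixDescartes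

namespace ZeroChange

open Polynomial Finset

/-- **`OneRowZeroChange 1` (pen g9 Sketch text at `k = 1`, VERBATIM)**: one W row `(−α, κ, γ)` and one zero-change row have at most
`2·1 + 1 = 3` positive critical points — THEOREM 56.2 (a). -/
theorem oneRowZeroChange_one : ∀ (a c : ℕ), 0 < a → a < c → ∀ (α κ γ : ℝ) (p q s : Fin 1 → ℝ),
    0 < α → 0 ≤ κ → 0 < γ → (∀ i, 0 < p i ∧ 0 ≤ q i ∧ 0 < s i) →
    posCrit (row a c (-α) κ γ * ∏ i, row a c (p i) (q i) (s i)) ≤ 2 * 1 + 1 := by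
  intro a c ha hac α κ γ p q s hα hκ hγ h
  rw [Fin.prod_univ_one]
  exact twoRowWKK a c ha hac α κ γ (p 0) (q 0) (s 0) hα hκ hγ (h 0).1 (h 0).2.1 (h 0).2.2

end ZeroChange

end Summit.ValiantsHypothesis.ValiantsHypothesis.Theorems.LacunarySymmetroidMatrixDescartes
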